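import Summits.Ventures.YMGap.SlabAreaLawCNS
import Summits.QuantumFields.BalabanUV.InfraRed.StrongCouplingPoincareDoorSU3Sharp
import HarnessLib

/-!
# Venture YMGap, track (a) / A4, part 5 — the `SU(3)` rungs of the slab door (`d = 4`, Wilson units `β_W = 6/g²`)

HONEST FRAMING: venture file of the cell `pub-ymgap` (QuantumFields programme).  Kernel ARITHMETIC over the slab door of
`SlabAreaLaw` (`hasAreaLaw_of_oneLinkKRModulus`: a one-link Kantorovich–Rubinstein modulus `OneLinkKRModulus N R K` on the ball
`R ≥ 2(d−1)β` with `2(d−1)βK < 1` gives Wilson's AREA LAW modulo the printed Durhuus–Fröhlich/Cao–Nissim–Sheffield criterion, the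
tree's named fact `durhuusFrohlich_areaLaw_of_slabClustering d N`).  For `SU(3)` (`'t Hooft β = β_W/9`, tree coupling `β_W/3`, slab
radius `6β = 2β_W/3`):
* `su3_hasAreaLaw_lt_threeEighths` — hypothesis-free on the one-link side (Bakry–Émery modulus): AREA LAW for `0 ≤ β_W < 3/8`,
  which is EXACTLY the printed CNS25 Thm. 1.6 threshold `1/(8(d−1)) = 1/24` in 't Hooft units (consistency; nothing new);
* `su3_hasAreaLaw_of_poincare_of_varianceBound` — the door fed with pub-balaban's Poincaré–variance modulus
  `OneLinkKRModulus 3 R √(cv)` (`oneLinkKRModulus_of_poincare_of_varianceBound`, leaf (40)): the two HYPOTHESIS SCHEMAS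
  `OneLinkPoincareSUN 3 R c`, `OneLinkVarianceBound 3 R v` (displayed as binders, NOT proved, NOT certified at filing — see the status
  line of `StrongCouplingPoincareDoorSU3Sharp`) with `R ≥ 2β_W/3` and the SLAB door product `(2β_W/3)²·(cv) < 1` give the area law at
  `β_W`.  The slab door constant is ONE THIRD of the DLR door's (`18·β_W/9 = 2β_W` there): each slab site has `2(d−1)` neighbours;
* `su3_hasAreaLaw_le_elevenTwentieths` — the instance booked by the cell lead (PLAN R61/R80): IF `OneLinkPoincareSUN 3 (11/30) (53/100)`
  AND `OneLinkVarianceBound 3 (11/30) (49/20)` (leaf (41)'s displayed hypotheses, uncertified) THEN, modulo the DF/CNS named fact, AREA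
  LAW for `SU(3)`, `d = 4`, for ALL `0 ≤ β_W ≤ 11/20` — against the printed `3/8`.  The cap `11/20` is the RADIUS at which the two
  hypotheses are displayed (`2β_W/3 ≤ 11/30`), not the door: the slab door product there is `(11/30)²·(53/100)(49/20) = 0.1746 < 1`
  (`su3_slabDoor_numbers`), whereas the DLR door of leaf (41) is shut at `11/20` with the same constants;
* `su3_hasAreaLaw_le_half` — the same with leaf (40)'s displayed pair `(1/3; 3/5, 5/2)`: `β_W ≤ 1/2`.
CLASS: K-conditional — on the printed DF/CNS criterion (P) for the `3/8` rung; on (P) AND the two uncertified one-link schemas for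
`1/2` and `11/20`.  Strong-coupling LATTICE statements only; no continuum limit, no mass-gap or Clay claim.
-/

noncomputable section

open MeasureTheory ProbabilityTheory
open Literature.MathematicalPhysics.QuantumLattice
open Literature.MathematicalPhysics.QuantumFieldTheory
open Literature.MathematicalPhysics.QuantumFieldTheory.Balaban1983to89.StrongCouplingDobrushinWindow
open Summit.QuantumFields.BalabanUV.InfraRed.StrongCouplingVarianceDoorSUN (OneLinkVarianceBound mul_sqrt_lt_one)
open Summit.QuantumFields.BalabanUV.InfraRed.StrongCouplingPoincareDoorSUN
  (OneLinkPoincareSUN oneLinkKRModulus_of_poincare_of_varianceBound)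

namespace Summit.Ventures.YMGap.Slab

/-- **`SU(3)`, `d = 4`, Wilson units, hypothesis-free on the one-link side**: the slab door with the tree's Bakry–Émery modulus gives
Wilson's AREA LAW `HasAreaLaw 4 (fundamentalRep (Fin 3)) (β_W/3)` for all `0 ≤ β_W < 3/8`, modulo the printed Durhuus–Fröhlich/CNS
criterion — exactly CNS25 Thm. 1.6 for `SU(3)` ('t Hooft `β_W/9 < 1/24`); a units corollary of `hasAreaLaw_of_lt_cnsThreshold`,
nothing new is claimed. [cite: CaoNissimSheffield2025dynamical, Theorems 1.6 and 2.3] -/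
theorem su3_hasAreaLaw_lt_threeEighths (h : durhuusFrohlich_areaLaw_of_slabClustering 4 3) {βW : ℝ} (hβ : 0 ≤ βW)
    (hlt : βW < 3 / 8) : HasAreaLaw 4 (fundamentalRep (Fin 3)) (βW / 3) := by
  have h3 : ((3 : ℕ) : ℝ) * (βW / 9) = βW / 3 := by push_cast; ring
  rw [← h3]
  exact hasAreaLaw_of_lt_cnsThreshold h (by norm_num) (by norm_num) (by positivity) (by push_cast; linarith)

/-- **`SU(3)`, `d = 4`, Wilson units — the slab door fed with the Poincaré–variance modulus** (both one-link hypothesis schemas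
DISPLAYED, nothing asserted about them): `OneLinkPoincareSUN 3 R c` and `OneLinkVarianceBound 3 R v` on a ball `R ≥ 2β_W/3` with
`0 ≤ c, v` give `OneLinkKRModulus 3 R √(cv)` (pub-balaban leaf (40)), and the SLAB Dobrushin condition `2(d−1)·(β_W/9)·√(cv) < 1`,
i.e. `(2β_W/3)²·(cv) < 1`, then gives — modulo the printed DF/CNS criterion — `HasAreaLaw 4 (fundamentalRep (Fin 3)) (β_W/3)`.  This
is the statement a later certificate of the two constants plugs into; its door constant is one third of the DLR door's
(`su3_fronts_of_poincare_of_varianceBound`: `(18·β_W/9)²·(cv) < 1`). [cite: CaoNissimSheffield2025dynamical, Theorem 2.3]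
[cite: Follmer1988, Ch. I Theorem (2.13)] -/
theorem su3_hasAreaLaw_of_poincare_of_varianceBound (h : durhuusFrohlich_areaLaw_of_slabClustering 4 3)
    {βW R c v : ℝ} (hβ : 0 ≤ βW) (hc : 0 ≤ c) (hv0 : 0 ≤ v) (hR : 2 * βW / 3 ≤ R)
    (hP : OneLinkPoincareSUN 3 R c) (hv : OneLinkVarianceBound 3 R v) (hdoor : (2 * βW / 3) ^ 2 * (c * v) < 1) :
    HasAreaLaw 4 (fundamentalRep (Fin 3)) (βW / 3) := by
  have h3 : ((3 : ℕ) : ℝ) * (βW / 9) = βW / 3 := by push_cast; ring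
  rw [← h3]
  have hmod := oneLinkKRModulus_of_poincare_of_varianceBound hc hv0 hP hv
  refine hasAreaLaw_of_oneLinkKRModulus h (by norm_num) (by norm_num) (β := βW / 9) (R := R)
    (K := Real.sqrt (c * v)) (by positivity) (Real.sqrt_nonneg _) (by push_cast; linarith) hmod ?_
  have key := mul_sqrt_lt_one (show 0 ≤ 2 * βW / 3 by positivity) hdoor
  have e : 2 * (((4 : ℕ) : ℝ) - 1) * (βW / 9) * Real.sqrt (c * v) = 2 * βW / 3 * Real.sqrt (c * v) := by
    push_cast; ring
  rw [e]
  exact key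

/-- **`SU(3)` AREA LAW FOR ALL `0 ≤ β_W ≤ 11/20`, `d = 4` — CONDITIONAL** (the cell's booked rung, PLAN R61/R80): IF
`OneLinkPoincareSUN 3 (11/30) (53/100)` (spectral gap `≥ 100/53` of the tilted one-link law on `‖B‖_op ≤ 11/30`; NOT proved —
Bakry–Émery gives only `5/2`) AND `OneLinkVarianceBound 3 (11/30) (49/20)` (NOT proved) — pub-balaban leaf (41)'s displayed,
uncertified hypotheses — THEN, modulo the printed Durhuus–Fröhlich/CNS criterion (named fact), Wilson's AREA LAW
`HasAreaLaw 4 (fundamentalRep (Fin 3)) (β_W/3)` holds for every `0 ≤ β_W ≤ 11/20`.  Printed comparison: CNS25 Thm. 1.6 gives `β_W < 3/8`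
(`su3_hasAreaLaw_lt_threeEighths`).  The cap `11/20` is the radius of the hypotheses (`2β_W/3 ≤ 11/30`); the slab door product there is
only `(11/30)²·(53/100)(49/20) = 0.17461…` (`su3_slabDoor_numbers`).  Class: K-conditional on THREE displayed hypotheses; strong-coupling
lattice statement only. [cite: CaoNissimSheffield2025dynamical, Theorems 1.6 and 2.3] -/
theorem su3_hasAreaLaw_le_elevenTwentieths (h : durhuusFrohlich_areaLaw_of_slabClustering 4 3)
    (hP : OneLinkPoincareSUN 3 (11 / 30) (53 / 100)) (hv : OneLinkVarianceBound 3 (11 / 30) (49 / 20))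
    {βW : ℝ} (hβ : 0 ≤ βW) (hle : βW ≤ 11 / 20) : HasAreaLaw 4 (fundamentalRep (Fin 3)) (βW / 3) := by
  refine su3_hasAreaLaw_of_poincare_of_varianceBound h hβ (by norm_num) (by norm_num) (by linarith) hP hv ?_
  have h0 : 0 ≤ 2 * βW / 3 := by positivity
  have h1 : 2 * βW / 3 ≤ 11 / 30 := by linarith
  have hsq : (2 * βW / 3) ^ 2 ≤ (11 / 30) ^ 2 := pow_le_pow_left₀ h0 h1 2
  exact lt_of_le_of_lt (mul_le_mul_of_nonneg_right hsq (by norm_num)) (by norm_num)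

/-- **`SU(3)` AREA LAW FOR ALL `0 ≤ β_W ≤ 1/2` — CONDITIONAL on leaf (40)'s displayed pair**: IF `OneLinkPoincareSUN 3 (1/3) (3/5)` AND
`OneLinkVarianceBound 3 (1/3) (5/2)` (NOT proved) THEN, modulo the DF/CNS named fact, `HasAreaLaw 4 (fundamentalRep (Fin 3)) (β_W/3)` for
`0 ≤ β_W ≤ 1/2` (slab door product `(1/3)²·(3/2) = 1/6`).  Implied by the `11/20` rung's hypotheses through leaf (41)'s monotonicity lemmas;
recorded for the ladder. [cite: CaoNissimSheffield2025dynamical, Theorem 2.3] -/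
theorem su3_hasAreaLaw_le_half (h : durhuusFrohlich_areaLaw_of_slabClustering 4 3)
    (hP : OneLinkPoincareSUN 3 (1 / 3) (3 / 5)) (hv : OneLinkVarianceBound 3 (1 / 3) (5 / 2))
    {βW : ℝ} (hβ : 0 ≤ βW) (hle : βW ≤ 1 / 2) : HasAreaLaw 4 (fundamentalRep (Fin 3)) (βW / 3) := by
  refine su3_hasAreaLaw_of_poincare_of_varianceBound h hβ (by norm_num) (by norm_num) (by linarith) hP hv ?_
  have h0 : 0 ≤ 2 * βW / 3 := by positivity
  have h1 : 2 * βW / 3 ≤ 1 / 3 := by linarith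
  have hsq : (2 * βW / 3) ^ 2 ≤ (1 / 3) ^ 2 := pow_le_pow_left₀ h0 h1 2
  exact lt_of_le_of_lt (mul_le_mul_of_nonneg_right hsq (by norm_num)) (by norm_num)

/-- Numbers of this leaf: the slab door products at the two conditional rungs (`0.17461…` at `11/20`, `1/6` at `1/2`) against the DLR door
of pub-balaban leaf (41), which is SHUT at `11/20` with the same constants (`(18·(11/20)/9)²·(53/100)(49/20) = 1.571… ≥ 1`); the slab door
constant `2β_W/3 = 6·(β_W/9)` is one third of the DLR door's `18·(β_W/9)`; the printed rung `3/8` lies below both conditional rungs; and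
— for orientation only, NO theorem uses it — with the same two constants the slab door product would stay `< 1` up to `2β_W/3 < (2000/2597)^{1/2}`,
e.g. at `2β_W/3 = 7/8` (`β_W = 21/16`): `(7/8)²·(2597/2000) = 0.994… < 1`, far outside the radius where anything is displayed. [folklore] -/
theorem su3_slabDoor_numbers :
    (11 / 30 : ℝ) ^ 2 * (53 / 100 * (49 / 20)) < 1 ∧ (1 / 3 : ℝ) ^ 2 * (3 / 5 * (5 / 2)) = 1 / 6 ∧
      ¬ (18 * ((11 / 20 : ℝ) / 9)) ^ 2 * (53 / 100 * (49 / 20)) < 1 ∧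
      (2 : ℝ) * (11 / 20) / 3 = 6 * ((11 / 20) / 9) ∧ (18 : ℝ) * ((11 / 20) / 9) = 3 * (2 * (11 / 20) / 3) ∧
      (3 : ℝ) / 8 < 1 / 2 ∧ (1 : ℝ) / 2 < 11 / 20 ∧
      (7 / 8 : ℝ) ^ 2 * (53 / 100 * (49 / 20)) < 1 := by
  norm_num

end Summit.Ventures.YMGap.Slab
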